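import Summits.Ventures.CertifiedManyBodySolver.Downfold.EmeryShapeTrueCornerRule
import Summits.Ventures.CertifiedManyBodySolver.Downfold.EmeryFermiScalePointsBi2223IPK11TrueCorners
import Summits.Ventures.CertifiedManyBodySolver.Downfold.EmeryFermiScalePointsBi2223IPK11VirtualCorners
import HarnessLib

/-!
# THE ONE-BAND FERMI-SURFACE SHAPE `t′/t` OF THE WHOLE TYPED 3BE BOX `emeryBoxBi2223IPK11Src (EmeryBoxesKSlicesP)` AT ITS TWO TRUE CORNERS (true-corner rule under certified margins, §B.87 (i);
# router/EMERY-SHAPE-CORNERS.tsv «true» rows)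

Venture CertifiedManyBodySolver, cell `pub/hubbard-downfold` (stage S1; INFLATION-RULES-3to1-B §B.87 (i)), seat hubbard-downfold-mod-4 (technique B, g35); namespace
`Summit.Ventures.CertifiedManyBodySolver.Downfold.Emery`. Everything PROVED (0 sorry). WHAT THIS IS NOT: a statement about Bi₂Sr₂Ca₂Cu₃O₁₀ INNER plane ((K) source box) — the typed box is SCREENING-GRADE; `U = 0`
one-body kinematics of the σ model; object E = the EXACT `t–t′` shape of the σ Fermi surface at the row's own Fermi energy.

For EVERY one-body row of `[2.06, 2.66] × [1.18, 1.39] × [0.62, 0.73] × [0.15, 0.18]` eV the one-band `t′/t` lies between its values at the TRUE corners `(Δ₁, a₁, b₂, c₂)` and `(Δ₂, a₂, b₁, c₁)`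
(`EmeryShapeTrueCornerRule`; the t_pp / t_pp′ directions by the MARGIN LEVERS of `EmeryMarginLevers`, margins certified by `norm_num` with the constants `M` printed below), read
over their K = 384 brackets (`EmeryFermiScalePointsBi2223IPK11TrueCorners`).

| filling | **true-corner window (certified)** | margins (t_pp lower/upper; t_pp′ lower/upper) | two-ray (§B.86 (i)) | g19 sub-box device |
|---|---|---|---|---|
| n_H = 1.156 (ν = 211/500) | **[-0.3108, -0.248]** | M_b 0.1135 / 2.0094; M_c 0.3998 / 0.0 | see EmeryBoxesBi2223IPK11ShapeCorners | [-0.3135,-0.2463] (n_H band) |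
| n_H = 1.197 (ν = 803/2000) | **[-0.3107, -0.2482]** | M_b 0.146 / 2.0445; M_c 0.3537 / 0.0 | see EmeryBoxesBi2223IPK11ShapeCorners | [-0.3135,-0.2463] (n_H band) |

Sources: three-band model [HybertsenSchluterChristensen1989, Eq. (1)]; [AndersenEtAl1995, §6]; box rows as cited in the typed object's file.
-/

noncomputable section

namespace Summit.Ventures.CertifiedManyBodySolver.Downfold.Emery

open Real Set

/-- **n_H = 1.156 (ν = 211/500): for every row of the box the one-band Fermi-surface `t′/t` (object E) lies in `[-0.3108, -0.248]` — its values at the two TRUE corners** (margin levers; margins by `norm_num`). [folklore] -/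
theorem bi2223IPK11Box_fsRatio_true_nH1156 {Δ a b c : ℝ} (hΔ : Δ ∈ Icc ((103 : ℝ) / 50) ((133 : ℝ) / 50)) (ha : a ∈ Icc ((59 : ℝ) / 50) ((139 : ℝ) / 100)) (hb : b ∈ Icc ((31 : ℝ) / 50) ((73 : ℝ) / 100)) (hc : c ∈ Icc ((3 : ℝ) / 20) ((9 : ℝ) / 50)) :
    fsRatio Δ a b c (fermiEnergyOf Δ a b c ((211 : ℝ) / 500)) ∈ Icc ((-777 : ℝ) / 2500) ((-31 : ℝ) / 125) := by
  have hSL := (fermiEnergyOf_of_pointBracketCheck truePt_Bi2223IPK11SL_nH1156_br (by norm_num) (by norm_num) (by norm_num) (ν := (211/500 : ℝ)) (by push_cast; exact ⟨le_rfl, le_rfl⟩)).2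
  have hTL := (fermiEnergyOf_of_pointBracketCheck truePt_Bi2223IPK11TL_nH1156_br (by norm_num) (by norm_num) (by norm_num) (ν := (211/500 : ℝ)) (by push_cast; exact ⟨le_rfl, le_rfl⟩)).2
  have hSU := (fermiEnergyOf_of_pointBracketCheck truePt_Bi2223IPK11SU_nH1156_br (by norm_num) (by norm_num) (by norm_num) (ν := (211/500 : ℝ)) (by push_cast; exact ⟨le_rfl, le_rfl⟩)).2
  have hQU := (fermiEnergyOf_of_pointBracketCheck truePt_Bi2223IPK11QU_nH1156_br (by norm_num) (by norm_num) (by norm_num) (ν := (211/500 : ℝ)) (by push_cast; exact ⟨le_rfl, le_rfl⟩)).2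
  have hTH := (fermiEnergyOf_of_pointBracketCheck truePt_Bi2223IPK11TH_nH1156_br (by norm_num) (by norm_num) (by norm_num) (ν := (211/500 : ℝ)) (by push_cast; exact ⟨le_rfl, le_rfl⟩)).2
  have hAlo := (fermiEnergyOf_of_pointBracketCheck virtPt_Bi2223IPK11Alo_nH1156_br (by norm_num) (by norm_num) (by norm_num) (ν := (211/500 : ℝ)) (by push_cast; exact ⟨le_rfl, le_rfl⟩)).2
  have hTop := (fermiEnergyOf_of_pointBracketCheck virtPt_Bi2223IPK11H_nH1156_br (by norm_num) (by norm_num) (by norm_num) (ν := (211/500 : ℝ)) (by push_cast; exact ⟨le_rfl, le_rfl⟩)).2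
  push_cast at hSL hTL hSU hQU hTH hAlo hTop
  norm_num at hSL hTL hSU hQU hTH hAlo hTop
  obtain ⟨hΔl, hΔu⟩ := hΔ
  obtain ⟨hal, hau⟩ := ha
  constructor
  · have hlow := fsRatio_fermiEnergyOf_trueCorner_lower (Δ₁ := ((103 : ℝ) / 50)) (a₁ := ((59 : ℝ) / 50)) (b₁ := ((31 : ℝ) / 50)) (b₂ := ((73 : ℝ) / 100)) (c₁ := ((3 : ℝ) / 20)) (c₂ := ((9 : ℝ) / 50))
      (ν := ((211 : ℝ) / 500)) (pL := ((3553 : ℝ) / 2500)) (qL := ((14847 : ℝ) / 10000)) (Mb := ((227 : ℝ) / 2000)) (Mc := ((1999 : ℝ) / 5000)) (by norm_num) hΔl (by norm_num) hal (by norm_num) hb (by norm_num) hc (by norm_num) (by norm_num) (by norm_num)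
      (by norm_num) hSL.1 hAlo.2 (by norm_num) (by norm_num [fsD, fsN]) (by norm_num) (by norm_num) (by norm_num [fsD, fsN]) (by norm_num) (by norm_num [dopingDisc]) (by norm_num [fsD, fsN])
    refine le_trans ?_ hlow
    have hw := (fsRatio_mem_Icc_on_window_of_dopingDisc_nonneg (Δ := ((103 : ℝ) / 50)) (a := ((59 : ℝ) / 50)) (b := ((73 : ℝ) / 100)) (c := ((9 : ℝ) / 50))
      (p := ((2901 : ℝ) / 2000)) (q := ((2921 : ℝ) / 2000)) (by norm_num) (by norm_num) (by norm_num) (by norm_num) (by norm_num) (by norm_num) (by norm_num) (by norm_num [dopingDisc]) hTL).1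
    refine le_trans ?_ hw
    norm_num [fsRatio, fsD, fsN]
  · have hup := fsRatio_fermiEnergyOf_trueCorner_upper (Δ₁ := ((103 : ℝ) / 50)) (Δ₂ := ((133 : ℝ) / 50)) (a₁ := ((59 : ℝ) / 50)) (a₂ := ((139 : ℝ) / 100)) (b₁ := ((31 : ℝ) / 50)) (b₂ := ((73 : ℝ) / 100)) (c₁ := ((3 : ℝ) / 20)) (c₂ := ((9 : ℝ) / 50))
      (ν := ((211 : ℝ) / 500)) (pU := ((16087 : ℝ) / 10000)) (qU := ((8331 : ℝ) / 5000)) (qT := ((18549 : ℝ) / 10000)) (Mb := ((10047 : ℝ) / 5000)) (Mc := (0 : ℝ)) (by norm_num) ⟨hΔl, hΔu⟩ (by norm_num) ⟨hal, hau⟩ (by norm_num) hb (by norm_num) hc (by norm_num) (by norm_num) (by norm_num)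
      hTop.2 (by norm_num) (by norm_num) hSU.1 hQU.2 (by norm_num) (by norm_num [fsD, fsN]) (by norm_num) (by norm_num) (by norm_num [fsD, fsN]) (by norm_num) (by norm_num) (by norm_num [fsD, fsN])
    refine le_trans hup ?_
    have hw := (fsRatio_mem_Icc_on_window_of_dopingDisc_nonpos (Δ := ((133 : ℝ) / 50)) (a := ((139 : ℝ) / 100)) (b := ((31 : ℝ) / 50)) (c := ((3 : ℝ) / 20))
      (p := ((16319 : ℝ) / 10000)) (q := ((16419 : ℝ) / 10000)) (by norm_num) (by norm_num) (by norm_num) (by norm_num) (by norm_num) (by norm_num) (by norm_num) (by norm_num [dopingDisc]) hTH).2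
    refine le_trans hw ?_
    norm_num [fsRatio, fsD, fsN]

/-- **n_H = 1.197 (ν = 803/2000): for every row of the box the one-band Fermi-surface `t′/t` (object E) lies in `[-0.3107, -0.2482]` — its values at the two TRUE corners** (margin levers; margins by `norm_num`). [folklore] -/
theorem bi2223IPK11Box_fsRatio_true_nH1197 {Δ a b c : ℝ} (hΔ : Δ ∈ Icc ((103 : ℝ) / 50) ((133 : ℝ) / 50)) (ha : a ∈ Icc ((59 : ℝ) / 50) ((139 : ℝ) / 100)) (hb : b ∈ Icc ((31 : ℝ) / 50) ((73 : ℝ) / 100)) (hc : c ∈ Icc ((3 : ℝ) / 20) ((9 : ℝ) / 50)) :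
    fsRatio Δ a b c (fermiEnergyOf Δ a b c ((803 : ℝ) / 2000)) ∈ Icc ((-3107 : ℝ) / 10000) ((-1241 : ℝ) / 5000) := by
  have hSL := (fermiEnergyOf_of_pointBracketCheck truePt_Bi2223IPK11SL_nH1197_br (by norm_num) (by norm_num) (by norm_num) (ν := (803/2000 : ℝ)) (by push_cast; exact ⟨le_rfl, le_rfl⟩)).2
  have hTL := (fermiEnergyOf_of_pointBracketCheck truePt_Bi2223IPK11TL_nH1197_br (by norm_num) (by norm_num) (by norm_num) (ν := (803/2000 : ℝ)) (by push_cast; exact ⟨le_rfl, le_rfl⟩)).2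
  have hSU := (fermiEnergyOf_of_pointBracketCheck truePt_Bi2223IPK11SU_nH1197_br (by norm_num) (by norm_num) (by norm_num) (ν := (803/2000 : ℝ)) (by push_cast; exact ⟨le_rfl, le_rfl⟩)).2
  have hQU := (fermiEnergyOf_of_pointBracketCheck truePt_Bi2223IPK11QU_nH1197_br (by norm_num) (by norm_num) (by norm_num) (ν := (803/2000 : ℝ)) (by push_cast; exact ⟨le_rfl, le_rfl⟩)).2
  have hTH := (fermiEnergyOf_of_pointBracketCheck truePt_Bi2223IPK11TH_nH1197_br (by norm_num) (by norm_num) (by norm_num) (ν := (803/2000 : ℝ)) (by push_cast; exact ⟨le_rfl, le_rfl⟩)).2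
  have hAlo := (fermiEnergyOf_of_pointBracketCheck virtPt_Bi2223IPK11Alo_nH1197_br (by norm_num) (by norm_num) (by norm_num) (ν := (803/2000 : ℝ)) (by push_cast; exact ⟨le_rfl, le_rfl⟩)).2
  have hTop := (fermiEnergyOf_of_pointBracketCheck virtPt_Bi2223IPK11H_nH1197_br (by norm_num) (by norm_num) (by norm_num) (ν := (803/2000 : ℝ)) (by push_cast; exact ⟨le_rfl, le_rfl⟩)).2
  push_cast at hSL hTL hSU hQU hTH hAlo hTop
  norm_num at hSL hTL hSU hQU hTH hAlo hTop
  obtain ⟨hΔl, hΔu⟩ := hΔ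
  obtain ⟨hal, hau⟩ := ha
  constructor
  · have hlow := fsRatio_fermiEnergyOf_trueCorner_lower (Δ₁ := ((103 : ℝ) / 50)) (a₁ := ((59 : ℝ) / 50)) (b₁ := ((31 : ℝ) / 50)) (b₂ := ((73 : ℝ) / 100)) (c₁ := ((3 : ℝ) / 20)) (c₂ := ((9 : ℝ) / 50))
      (ν := ((803 : ℝ) / 2000)) (pL := ((3467 : ℝ) / 2500)) (qL := ((2891 : ℝ) / 2000)) (Mb := ((73 : ℝ) / 500)) (Mc := ((3537 : ℝ) / 10000)) (by norm_num) hΔl (by norm_num) hal (by norm_num) hb (by norm_num) hc (by norm_num) (by norm_num) (by norm_num)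
      (by norm_num) hSL.1 hAlo.2 (by norm_num) (by norm_num [fsD, fsN]) (by norm_num) (by norm_num) (by norm_num [fsD, fsN]) (by norm_num) (by norm_num [dopingDisc]) (by norm_num [fsD, fsN])
    refine le_trans ?_ hlow
    have hw := (fsRatio_mem_Icc_on_window_of_dopingDisc_nonneg (Δ := ((103 : ℝ) / 50)) (a := ((59 : ℝ) / 50)) (b := ((73 : ℝ) / 100)) (c := ((9 : ℝ) / 50))
      (p := ((14111 : ℝ) / 10000)) (q := ((14211 : ℝ) / 10000)) (by norm_num) (by norm_num) (by norm_num) (by norm_num) (by norm_num) (by norm_num) (by norm_num) (by norm_num [dopingDisc]) hTL).1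
    refine le_trans ?_ hw
    norm_num [fsRatio, fsD, fsN]
  · have hup := fsRatio_fermiEnergyOf_trueCorner_upper (Δ₁ := ((103 : ℝ) / 50)) (Δ₂ := ((133 : ℝ) / 50)) (a₁ := ((59 : ℝ) / 50)) (a₂ := ((139 : ℝ) / 100)) (b₁ := ((31 : ℝ) / 50)) (b₂ := ((73 : ℝ) / 100)) (c₁ := ((3 : ℝ) / 20)) (c₂ := ((9 : ℝ) / 50))
      (ν := ((803 : ℝ) / 2000)) (pU := ((3939 : ℝ) / 2500)) (qU := ((16287 : ℝ) / 10000)) (qT := ((18087 : ℝ) / 10000)) (Mb := ((4089 : ℝ) / 2000)) (Mc := (0 : ℝ)) (by norm_num) ⟨hΔl, hΔu⟩ (by norm_num) ⟨hal, hau⟩ (by norm_num) hb (by norm_num) hc (by norm_num) (by norm_num) (by norm_num)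
      hTop.2 (by norm_num) (by norm_num) hSU.1 hQU.2 (by norm_num) (by norm_num [fsD, fsN]) (by norm_num) (by norm_num) (by norm_num [fsD, fsN]) (by norm_num) (by norm_num) (by norm_num [fsD, fsN])
    refine le_trans hup ?_
    have hw := (fsRatio_mem_Icc_on_window_of_dopingDisc_nonpos (Δ := ((133 : ℝ) / 50)) (a := ((139 : ℝ) / 100)) (b := ((31 : ℝ) / 50)) (c := ((3 : ℝ) / 20))
      (p := ((8 : ℝ) / 5)) (q := ((161 : ℝ) / 100)) (by norm_num) (by norm_num) (by norm_num) (by norm_num) (by norm_num) (by norm_num) (by norm_num) (by norm_num [dopingDisc]) hTH).2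
    refine le_trans hw ?_
    norm_num [fsRatio, fsD, fsN]

end Summit.Ventures.CertifiedManyBodySolver.Downfold.Emery
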